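import Summits.ABC.ABC.Theorems.TwistAmplificationSharpModerateLawCuspDispersionThickDefs
import Summits.ABC.ABC.Theorems.TwistAmplificationSharpModerateLawResolvedReduction
import Literature.NumberTheory.Sieve.DivisorBound

/-!
# Crux `TwistAmplification.SharpModerateLaw` (stmt-ABC-1975), line `deep-moduli-cusp-dispersion`:
the two thick regimes are equivalent to their conductor-free class sum `ThickMissingTw`

Worker W6 of lead `prover-line-stmt-ABC-1975-c2-0` (wave 2), 2026-08-16. The line's two open thick stubs
(`stub_resolvedRegime : … → LawOn ResolvedRegimeTw`, `stub_deepRegime : … → LawOn DeepRegimeTw`; jointly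
`LawOn ThickTw`, `lawOn_thickTw_of_lawOn_regimesTw`) get ONE named conductor-free core `ThickMissingTw`
(file `…CuspDispersionThickDefs.lean`), and this file proves the two registered sub-goals

* `lawOn_thickTw_of_thickMissing : ThickMissingTw → LawOn ThickTw` (§1): every pair `x = (u, v)` of the dyadic
  cusp set in the twist-aware thick tube lies in the thick class `thickClass e g X Y` of its own datum
  (`datum_arith`: `g` = the `u`-part of `|Δ|`, `e` = the powerful part of the `u`-coprime part, `Δ = (u³−v²)/1728`),
  with `1 ≤ e, g ≤ |Δ| ≤ Y`, the class inequality being `|Δ|·rad e·(rad g)² = e·g·(r·rad e·(rad g)²) ≤ e·g·N* ≤ e·g·X`;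
  so the thick set injects into the finite union of the classes (near-copy of `…ResolvedReduction.lean` with the
  `r'`-threshold deleted). Corollaries: the law on each thick regime, the two reshaped stub statements
  `ResolvedRegimeLawTw`, `DeepRegimeLawTw`, and `ResolvedMissingTw`, all from `ThickMissingTw`.
* `thickMissingTw_of_lawOn_thickTw : LawOn ThickTw → ThickMissingTw` (§2, the converse): (i) every class sits inside
  the thick set at the SAME scales, because for a member `N* ≤ (rad g)²·rad|c| ≤ (rad g)²·rad e·|c|/e`
  (`Δ = g·c`, `(u,c) = 1`, primes of `g` divide `u`, `e ∣ c`), so `N*·e·g ≤ |Δ|·rad e·(rad g)² ≤ e·g·X`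
  (`conductorProxy_mul_le`); (ii) a pair lies in at most `d(|Δ|)²` classes (`g ∣ |Δ|`, `e ∣ |Δ|`); (iii) swapping
  the sums, `Σ_{e,g} #class ≤ #thick set · max_x d(|Δ_x|)² ≤ C₀X^{ε/2}(XY^{-1/6}+1)·C_δ²Y^{2δ}` with the divisor
  bound (`Literature.NumberTheory.Sieve.exists_card_divisors_le_mul_rpow'`, Hardy–Wright Thm 315) at
  `δ = ε/(4σ)`, and `Y^{2δ} ≤ X^{2σδ} = X^{ε/2}` on the cone `Y ≤ X^σ`.

Hence `ThickMissingTw ↔ LawOn ThickTw ↔ (LawOn ResolvedRegimeTw ∧ LawOn DeepRegimeTw)`: the named core is the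
honest joint content of stubs 3–4, one typed target for the planner.
-/

noncomputable section

set_option linter.dupNamespace false

namespace Summit.ABC.ABC.Theorems.SharpModerateLaw.CuspDispersion

open scoped BigOperators

/-! ## 1. `ThickMissingTw → LawOn ThickTw`: every thick pair lies in the class of its datum -/

/-- **Every thick pair lies in the thick class of its datum**, with `e ≤ Y` powerful and `g ≤ Y`. -/
theorem exists_mem_thickClass {X Y : ℝ} {x : ℤ × ℤ} (hx : x ∈ cuspSetD X Y) (hth : ThickTw Y x) :
    ∃ e ∈ (Finset.Icc 1 ⌊Y⌋₊).filter (fun e : ℕ => ∀ p ∈ e.primeFactors, p ^ 2 ∣ e),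
      ∃ g ∈ Finset.Icc 1 ⌊Y⌋₊, x ∈ thickClass e g X Y := by
  obtain ⟨hu0, hv0, hne, h1728, hTF, hu3, hDle, hfloor, hN⟩ := hx
  have hD : x.1 ^ 3 - x.2 ^ 2 ≠ 0 := sub_ne_zero.mpr hne
  obtain ⟨e, g, r, c, he0, hg0, hn, hgc, hcop, hec, hgu, hpow, -, hNstar⟩ := datum_arith x hD h1728
  have hcast := abs_cast_eq_mul_natAbs h1728
  have hnY := natAbs_div_le h1728 hDle
  have hn0 := natAbs_div_ne_zero hD h1728
  set n : ℕ := ((x.1 ^ 3 - x.2 ^ 2) / 1728).natAbs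
  have heY : (e : ℝ) ≤ Y := by
    have : e ≤ n := Nat.le_of_dvd (Nat.pos_of_ne_zero hn0) ⟨g * r, by rw [hn]; ring⟩
    exact le_trans (by exact_mod_cast this) hnY
  have hgY : (g : ℝ) ≤ Y := by
    have : g ≤ n := Nat.le_of_dvd (Nat.pos_of_ne_zero hn0) ⟨e * r, hn⟩
    exact le_trans (by exact_mod_cast this) hnY
  refine ⟨e, Finset.mem_filter.mpr ⟨Finset.mem_Icc.mpr ⟨Nat.one_le_iff_ne_zero.mpr he0.ne',
      Nat.le_floor heY⟩, hpow⟩,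
    g, Finset.mem_Icc.mpr ⟨Nat.one_le_iff_ne_zero.mpr hg0.ne', Nat.le_floor hgY⟩, ?_⟩
  refine ⟨⟨⟨hu0, hv0, hne, hu3, hDle, hfloor⟩, h1728, hTF⟩, hth, hgu, ⟨c, hgc, hcop, hec⟩, ?_⟩
  -- `|Δ|·rad e·(rad g)² ≤ e·g·X`: from `|Δ| = g·e·r`, `r·rad e·(rad g)² ≤ N* ≤ X`
  set rade : ℕ := ∏ p ∈ e.primeFactors, p
  set radg : ℕ := ∏ p ∈ g.primeFactors, p
  have key : n * rade * radg ^ 2 ≤ e * g * Nstar x := by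
    calc n * rade * radg ^ 2 = (e * g) * (r * rade * radg ^ 2) := by rw [hn]; ring
      _ ≤ (e * g) * Nstar x := Nat.mul_le_mul_left _ hNstar
  have key' : (n : ℝ) * rade * (radg : ℝ) ^ 2 ≤ (e : ℝ) * g * (Nstar x : ℝ) := by
    exact_mod_cast key
  rw [hcast]
  calc 1728 * (n : ℝ) / 1728 * rade * (radg : ℝ) ^ 2 = (n : ℝ) * rade * (radg : ℝ) ^ 2 := by ring
    _ ≤ (e : ℝ) * g * (Nstar x : ℝ) := key'
    _ ≤ (e : ℝ) * g * X := by gcongr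

/-- The thick part of the cusp set has at most `Σ_{e ≤ Y powerful} Σ_{g ≤ Y} #thickClass e g X Y` members
(`Y ≥ 1`). -/
theorem ncard_thick_le_sum {X Y : ℝ} (hY : 1 ≤ Y) :
    (Set.ncard {x : ℤ × ℤ | x ∈ cuspSetD X Y ∧ ThickTw Y x} : ℝ) ≤
      ∑ e ∈ (Finset.Icc 1 ⌊Y⌋₊).filter (fun e : ℕ => ∀ p ∈ e.primeFactors, p ^ 2 ∣ e),
        ∑ g ∈ Finset.Icc 1 ⌊Y⌋₊, (Set.ncard (thickClass e g X Y) : ℝ) := by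
  set E := (Finset.Icc 1 ⌊Y⌋₊).filter (fun e : ℕ => ∀ p ∈ e.primeFactors, p ^ 2 ∣ e)
  set G := Finset.Icc 1 ⌊Y⌋₊
  have hsub : {x : ℤ × ℤ | x ∈ cuspSetD X Y ∧ ThickTw Y x} ⊆ ⋃ e ∈ E, ⋃ g ∈ G, thickClass e g X Y := by
    rintro x ⟨hx, hth⟩
    obtain ⟨e, he, g, hg, hmem⟩ := exists_mem_thickClass hx hth
    simp only [Set.mem_iUnion]
    exact ⟨e, he, g, hg, hmem⟩
  have hfin : (⋃ e ∈ E, ⋃ g ∈ G, thickClass e g X Y).Finite := by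
    refine (cuspBox_finite Y hY).subset ?_
    intro x hx
    simp only [Set.mem_iUnion] at hx
    obtain ⟨e, -, g, -, h⟩ := hx
    exact h.1
  have h1 := Set.ncard_le_ncard hsub hfin
  have h2 : (⋃ e ∈ E, ⋃ g ∈ G, thickClass e g X Y).ncard ≤ ∑ e ∈ E, ∑ g ∈ G, (thickClass e g X Y).ncard :=
    (Finset.set_ncard_biUnion_le E _).trans (Finset.sum_le_sum fun e _ => Finset.set_ncard_biUnion_le G _)
  exact_mod_cast h1.trans h2

/-- **The two thick regimes reduce to their conductor-free class sum**: `ThickMissingTw → LawOn ThickTw` (same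
constant; registered sub-goal of stmt-ABC-1975, line `deep-moduli-cusp-dispersion`). -/
theorem lawOn_thickTw_of_thickMissing : ThickMissingTw → LawOn ThickTw := by
  intro h σ hσ ε hε
  obtain ⟨C, hC⟩ := h σ hσ ε hε
  exact ⟨C, fun X Y hX hY hXY hYX => (ncard_thick_le_sum hY).trans (hC X Y hX hY hXY hYX)⟩

/-! ### Corollaries: the two thick regime laws, the reshaped stub statements, `ResolvedMissingTw` -/

/-- `LawOn ThickTw → LawOn ResolvedRegimeTw` (`ResolvedRegimeTw = ThickTw ∧ r' ≥ Y^{1/6}`). -/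
theorem lawOn_resolvedRegimeTw_of_lawOn_thickTw (h : LawOn ThickTw) : LawOn ResolvedRegimeTw :=
  lawOn_mono (fun _ _ hx => hx.1) h

/-- `LawOn ThickTw → LawOn DeepRegimeTw` (`DeepRegimeTw = ThickTw ∧ r' < Y^{1/6}`). -/
theorem lawOn_deepRegimeTw_of_lawOn_thickTw (h : LawOn ThickTw) : LawOn DeepRegimeTw :=
  lawOn_mono (fun _ _ hx => hx.1) h

/-- Conversely the two thick regime laws give the law on the thick tube (`ThickTw = ResolvedRegimeTw ∨ DeepRegimeTw`,
union bound), so `LawOn ThickTw` is exactly the joint content of stubs 3–4. -/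
theorem lawOn_thickTw_of_lawOn_regimesTw (h3 : LawOn ResolvedRegimeTw) (h4 : LawOn DeepRegimeTw) :
    LawOn ThickTw :=
  lawOn_mono (fun Y x hx => (le_or_gt (Y ^ (1 / 6 : ℝ)) (simpleRad x : ℝ)).imp (fun h => ⟨hx, h⟩)
    (fun h => ⟨hx, h⟩)) (lawOn_or h3 h4)

/-- `ThickMissingTw → LawOn ResolvedRegimeTw`. -/
theorem lawOn_resolvedRegimeTw_of_thickMissing (h : ThickMissingTw) : LawOn ResolvedRegimeTw :=
  lawOn_resolvedRegimeTw_of_lawOn_thickTw (lawOn_thickTw_of_thickMissing h)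

/-- `ThickMissingTw → LawOn DeepRegimeTw`. -/
theorem lawOn_deepRegimeTw_of_thickMissing (h : ThickMissingTw) : LawOn DeepRegimeTw :=
  lawOn_deepRegimeTw_of_lawOn_thickTw (lawOn_thickTw_of_thickMissing h)

/-- `ThickMissingTw` discharges the reshaped stub statement `stub_resolvedRegime` (`ResolvedRegimeLawTw`). -/
theorem resolvedRegimeLawTw_of_thickMissing (h : ThickMissingTw) : ResolvedRegimeLawTw :=
  fun _ _ => lawOn_resolvedRegimeTw_of_thickMissing h

/-- `ThickMissingTw` discharges the reshaped stub statement `stub_deepRegime` (`DeepRegimeLawTw`). -/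
theorem deepRegimeLawTw_of_thickMissing (h : ThickMissingTw) : DeepRegimeLawTw :=
  fun _ _ => lawOn_deepRegimeTw_of_thickMissing h

/-- `ThickMissingTw → ResolvedMissingTw` (classwise: `resolvedClass ⊆ thickClass`, classes are finite). -/
theorem resolvedMissingTw_of_thickMissingTw (h : ThickMissingTw) : ResolvedMissingTw := by
  intro σ hσ ε hε
  obtain ⟨C, hC⟩ := h σ hσ ε hε
  refine ⟨C, fun X Y hX hY hXY hYX => le_trans ?_ (hC X Y hX hY hXY hYX)⟩
  refine Finset.sum_le_sum fun e _ => Finset.sum_le_sum fun g _ => ?_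
  exact_mod_cast Set.ncard_le_ncard (resolvedClass_subset_thickClass e g X Y)
    ((cuspBox_finite Y hY).subset fun x hx => hx.1)

/-! ## 2. The converse `LawOn ThickTw → ThickMissingTw` -/

/-- **The conductor proxy of a datum.** With `Δ = g·c ≠ 0`, `(u, c) = 1`, every prime of `g` dividing `u` and
`e ∣ c`: `(∏_{p ∣ Δ} (p² if p ∣ u else p))·e·g ≤ |Δ|·rad e·(rad g)²` — the primes of `Δ` dividing `u` are primes
of `g`, the others are primes of `|c| = e·k`, and `rad(e·k)·e ≤ rad e·k·e = rad e·|c|`. -/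
theorem conductorProxy_mul_le {u Δ c : ℤ} {e g : ℕ} (hgc : Δ = g * c) (hcop : IsCoprime u c)
    (hec : (e : ℤ) ∣ c) (hgu : ∀ p ∈ g.primeFactors, (p : ℤ) ∣ u) (hΔ : Δ ≠ 0) :
    (∏ p ∈ Δ.natAbs.primeFactors, (if ((p : ℕ) : ℤ) ∣ u then p ^ 2 else p)) * e * g ≤
      Δ.natAbs * (∏ p ∈ e.primeFactors, p) * (∏ p ∈ g.primeFactors, p) ^ 2 := by
  obtain ⟨k, rfl⟩ := hec
  subst hgc
  have hn : ((g : ℤ) * ((e : ℤ) * k)).natAbs = g * (e * k.natAbs) := by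
    rw [Int.natAbs_mul, Int.natAbs_mul, Int.natAbs_natCast, Int.natAbs_natCast]
  have hg0 : g ≠ 0 := by rintro rfl; exact hΔ (by simp)
  have he0 : e ≠ 0 := by rintro rfl; exact hΔ (by simp)
  have hk0 : k.natAbs ≠ 0 := fun h => hΔ (by rw [Int.natAbs_eq_zero.mp h]; simp)
  have hm0 : e * k.natAbs ≠ 0 := mul_ne_zero he0 hk0
  rw [hn]
  set m : ℕ := e * k.natAbs with hm
  -- the primes of `Δ` dividing `u` are primes of `g`; the others are primes of `m = |c|`
  have hsub1 : (g * m).primeFactors.filter (fun p : ℕ => (p : ℤ) ∣ u) ⊆ g.primeFactors := by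
    intro p hp
    obtain ⟨hpn, hpu⟩ := Finset.mem_filter.mp hp
    have hpP := Nat.prime_of_mem_primeFactors hpn
    rcases (Nat.Prime.dvd_mul hpP).mp (Nat.dvd_of_mem_primeFactors hpn) with h | h
    · exact Nat.mem_primeFactors.mpr ⟨hpP, h, hg0⟩
    · exfalso
      have hpc : (p : ℤ) ∣ (e : ℤ) * k := by
        rw [Int.ofNat_dvd_left, Int.natAbs_mul, Int.natAbs_natCast]
        exact h
      have hunit := hcop.isUnit_of_dvd' hpu hpc
      rw [Int.isUnit_iff_natAbs_eq, Int.natAbs_natCast] at hunit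
      exact hpP.one_lt.ne' hunit
  have hsub2 : (g * m).primeFactors.filter (fun p : ℕ => ¬ (p : ℤ) ∣ u) ⊆ m.primeFactors := by
    intro p hp
    obtain ⟨hpn, hpu⟩ := Finset.mem_filter.mp hp
    have hpP := Nat.prime_of_mem_primeFactors hpn
    rcases (Nat.Prime.dvd_mul hpP).mp (Nat.dvd_of_mem_primeFactors hpn) with h | h
    · exact absurd (hgu p (Nat.mem_primeFactors.mpr ⟨hpP, h, hg0⟩)) hpu
    · exact Nat.mem_primeFactors.mpr ⟨hpP, h, hm0⟩
  -- `N ≤ (rad g)²·rad m`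
  have h1 : (∏ p ∈ (g * m).primeFactors.filter (fun p : ℕ => (p : ℤ) ∣ u), p ^ 2) ≤
      (∏ p ∈ g.primeFactors, p) ^ 2 := by
    rw [← Finset.prod_pow]
    exact Finset.prod_le_prod_of_subset_of_one_le' hsub1 fun p hp _ =>
      Nat.one_le_pow _ _ (Nat.prime_of_mem_primeFactors hp).pos
  have h2 : (∏ p ∈ (g * m).primeFactors.filter (fun p : ℕ => ¬ (p : ℤ) ∣ u), p) ≤
      ∏ p ∈ m.primeFactors, p :=
    Finset.prod_le_prod_of_subset_of_one_le' hsub2 fun p hp _ => (Nat.prime_of_mem_primeFactors hp).one_lt.le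
  -- `rad m ≤ rad e·|k|`
  have h3 : (∏ p ∈ m.primeFactors, p) ≤ (∏ p ∈ e.primeFactors, p) * k.natAbs := by
    rw [hm, Nat.primeFactors_mul he0 hk0]
    calc ∏ p ∈ e.primeFactors ∪ k.natAbs.primeFactors, p
        ≤ (∏ p ∈ e.primeFactors, p) * ∏ p ∈ k.natAbs.primeFactors, p := by
          rw [← Finset.prod_union_inter]
          exact Nat.le_mul_of_pos_right _ (Finset.prod_pos fun p hp =>
            (Nat.prime_of_mem_primeFactors (Finset.mem_inter.mp hp).1).pos)
      _ ≤ (∏ p ∈ e.primeFactors, p) * k.natAbs :=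
          Nat.mul_le_mul_left _ (Nat.le_of_dvd (Nat.pos_of_ne_zero hk0) (Nat.prod_primeFactors_dvd _))
  rw [Finset.prod_ite]
  calc (∏ p ∈ (g * m).primeFactors.filter (fun p : ℕ => (p : ℤ) ∣ u), p ^ 2) *
        (∏ p ∈ (g * m).primeFactors.filter (fun p : ℕ => ¬ (p : ℤ) ∣ u), p) * e * g
      ≤ (∏ p ∈ g.primeFactors, p) ^ 2 * ((∏ p ∈ e.primeFactors, p) * k.natAbs) * e * g := by
        gcongr
        exact h2.trans h3
    _ = g * (e * k.natAbs) * (∏ p ∈ e.primeFactors, p) * (∏ p ∈ g.primeFactors, p) ^ 2 := by ring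

/-- **Each thick class sits inside the thick part of the cusp set at the same scales**: a member has
`N*·e·g ≤ |Δ|·rad e·(rad g)² ≤ e·g·X`, i.e. `N* ≤ X`. -/
theorem thickClass_subset_thickSet (e g : ℕ) (X Y : ℝ) :
    thickClass e g X Y ⊆ {x : ℤ × ℤ | x ∈ cuspSetD X Y ∧ ThickTw Y x} := by
  rintro x ⟨⟨⟨hu, hv, hne, hu3, hDle, hfl⟩, h1728, hTF⟩, hth, hgu, ⟨c, hgc, hcop, hec⟩, hineq⟩
  refine ⟨⟨hu, hv, hne, h1728, hTF, hu3, hDle, hfl, ?_⟩, hth⟩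
  have hD : x.1 ^ 3 - x.2 ^ 2 ≠ 0 := sub_ne_zero.mpr hne
  have hn0 := natAbs_div_ne_zero hD h1728
  have hΔ0 : (x.1 ^ 3 - x.2 ^ 2) / 1728 ≠ 0 := Int.natAbs_ne_zero.mp hn0
  have hg0 : g ≠ 0 := by rintro rfl; apply hΔ0; rw [hgc]; simp
  have he0 : e ≠ 0 := by
    rintro rfl; apply hΔ0; obtain ⟨k, hk⟩ := hec; rw [hgc, hk]; simp
  have key : Nstar x * e * g ≤ ((x.1 ^ 3 - x.2 ^ 2) / 1728).natAbs * (∏ p ∈ e.primeFactors, p) *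
      (∏ p ∈ g.primeFactors, p) ^ 2 :=
    conductorProxy_mul_le hgc hcop hec hgu hΔ0
  have key' : (Nstar x : ℝ) * e * g ≤ ((((x.1 ^ 3 - x.2 ^ 2) / 1728).natAbs : ℕ) : ℝ) *
      ((∏ p ∈ e.primeFactors, p : ℕ) : ℝ) * ((∏ p ∈ g.primeFactors, p : ℕ) : ℝ) ^ 2 := by
    exact_mod_cast key
  rw [abs_cast_eq_mul_natAbs h1728] at hineq
  have heg : (0 : ℝ) < (e : ℝ) * g :=
    mul_pos (Nat.cast_pos.mpr (Nat.pos_of_ne_zero he0)) (Nat.cast_pos.mpr (Nat.pos_of_ne_zero hg0))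
  refine le_of_mul_le_mul_right ?_ heg
  calc (Nstar x : ℝ) * ((e : ℝ) * g) = (Nstar x : ℝ) * e * g := by ring
    _ ≤ _ := key'
    _ = 1728 * ((((x.1 ^ 3 - x.2 ^ 2) / 1728).natAbs : ℕ) : ℝ) / 1728 *
          ((∏ p ∈ e.primeFactors, p : ℕ) : ℝ) * ((∏ p ∈ g.primeFactors, p : ℕ) : ℝ) ^ 2 := by ring
    _ ≤ (e : ℝ) * g * X := hineq
    _ = X * ((e : ℝ) * g) := by ring

/-- **Multiplicity**: a pair `x` with `Δ ≠ 0` lies in at most `d(|Δ|)²` classes (`g ∣ |Δ|` and `e ∣ |c| ∣ |Δ|`). -/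
theorem card_filter_mem_thickClass_le (E G : Finset ℕ) (X Y : ℝ) (x : ℤ × ℤ)
    [DecidablePred fun q : ℕ × ℕ => x ∈ thickClass q.1 q.2 X Y] :
    ((E ×ˢ G).filter (fun q : ℕ × ℕ => x ∈ thickClass q.1 q.2 X Y)).card ≤
      (((x.1 ^ 3 - x.2 ^ 2) / 1728).natAbs.divisors.card) ^ 2 := by
  set n : ℕ := ((x.1 ^ 3 - x.2 ^ 2) / 1728).natAbs with hn
  rw [sq, ← Finset.card_product]
  refine Finset.card_le_card fun q hq => ?_
  obtain ⟨-, ⟨⟨-, -, hne, -⟩, h1728, -⟩, -, -, ⟨c, hgc, -, hec⟩, -⟩ := Finset.mem_filter.mp hq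
  have hn0 : n ≠ 0 := natAbs_div_ne_zero (sub_ne_zero.mpr hne) h1728
  have hnm : n = q.2 * c.natAbs := by rw [hn, hgc, Int.natAbs_mul, Int.natAbs_natCast]
  refine Finset.mem_product.mpr ⟨Nat.mem_divisors.mpr ⟨?_, hn0⟩, Nat.mem_divisors.mpr ⟨?_, hn0⟩⟩
  · exact (Int.ofNat_dvd_left.mp hec).trans ⟨q.2, by rw [hnm, mul_comm]⟩
  · exact ⟨c.natAbs, hnm⟩

/-- **Swapping the sums**: if every class lies in the finite set `T`, the double class sum is the sum over
`x ∈ T` of the number of data `(e, g)` whose class contains `x`. -/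
theorem sum_ncard_thickClass_eq (E G : Finset ℕ) (X Y : ℝ) {T : Finset (ℤ × ℤ)}
    [∀ x : ℤ × ℤ, DecidablePred fun q : ℕ × ℕ => x ∈ thickClass q.1 q.2 X Y]
    (hT : ∀ e ∈ E, ∀ g ∈ G, thickClass e g X Y ⊆ ↑T) :
    ∑ e ∈ E, ∑ g ∈ G, (thickClass e g X Y).ncard =
      ∑ x ∈ T, ((E ×ˢ G).filter (fun q : ℕ × ℕ => x ∈ thickClass q.1 q.2 X Y)).card := by
  have h1 : ∀ q ∈ E ×ˢ G,
      (thickClass q.1 q.2 X Y).ncard = ∑ x ∈ T, (if x ∈ thickClass q.1 q.2 X Y then 1 else 0) := by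
    intro q hq
    obtain ⟨he, hg⟩ := Finset.mem_product.mp hq
    rw [← Finset.card_filter, ← Set.ncard_coe_finset]
    congr 1
    ext x
    simp only [Finset.coe_filter, Set.mem_setOf_eq]
    exact ⟨fun hx => ⟨hT q.1 he q.2 hg hx, hx⟩, fun hx => hx.2⟩
  calc ∑ e ∈ E, ∑ g ∈ G, (thickClass e g X Y).ncard
      = ∑ q ∈ E ×ˢ G, (thickClass q.1 q.2 X Y).ncard :=
        (Finset.sum_product' E G fun e g => (thickClass e g X Y).ncard).symm
    _ = ∑ q ∈ E ×ˢ G, ∑ x ∈ T, (if x ∈ thickClass q.1 q.2 X Y then 1 else 0) := Finset.sum_congr rfl h1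
    _ = ∑ x ∈ T, ∑ q ∈ E ×ˢ G, (if x ∈ thickClass q.1 q.2 X Y then 1 else 0) := Finset.sum_comm
    _ = ∑ x ∈ T, ((E ×ˢ G).filter (fun q : ℕ × ℕ => x ∈ thickClass q.1 q.2 X Y)).card :=
        Finset.sum_congr rfl fun x _ => by rw [Finset.card_filter]

/-- **The converse reduction**: `LawOn ThickTw → ThickMissingTw` (registered sub-goal of stmt-ABC-1975, line
`deep-moduli-cusp-dispersion`; constant `max C₀ 0 · C_δ²` from the law at `ε/2` and the divisor bound at
`δ = ε/(4σ)`). Together with `lawOn_thickTw_of_thickMissing`: `ThickMissingTw ↔ LawOn ThickTw`. -/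
theorem thickMissingTw_of_lawOn_thickTw : LawOn ThickTw → ThickMissingTw := by
  intro h σ hσ ε hε
  have hσ0 : 0 < σ := by linarith
  set δ : ℝ := ε / (4 * σ) with hδ
  have hδ0 : 0 < δ := by positivity
  have hσδ : σ * δ = ε / 4 := by rw [hδ]; field_simp
  obtain ⟨C₀, hC₀⟩ := h σ hσ (ε / 2) (by linarith)
  obtain ⟨C₁, hC₁1, hC₁⟩ := Literature.NumberTheory.Sieve.exists_card_divisors_le_mul_rpow' hδ0
  refine ⟨max C₀ 0 * C₁ ^ 2, fun X Y hX hY hXY hYX => ?_⟩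
  set E := (Finset.Icc 1 ⌊Y⌋₊).filter (fun e : ℕ => ∀ p ∈ e.primeFactors, p ^ 2 ∣ e)
  set G := Finset.Icc 1 ⌊Y⌋₊
  set B : ℝ := X * Y ^ (-(1 / 6 : ℝ)) + 1 with hB
  haveI : ∀ x : ℤ × ℤ, DecidablePred fun q : ℕ × ℕ => x ∈ thickClass q.1 q.2 X Y :=
    fun x => Classical.decPred _
  have hX0 : 0 < X := by linarith
  have hY0 : 0 ≤ Y := by linarith
  have hε4 : ε / 4 + ε / 4 = ε / 2 := by ring
  have hε2 : ε / 2 + ε / 2 = ε := by ring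
  have hB0 : 0 ≤ B := add_nonneg (mul_nonneg hX0.le (Real.rpow_nonneg hY0 _)) zero_le_one
  -- the finite thick set `T` and the class inclusions
  have hTfin := sepSet_finite ThickTw X Y hY
  set T : Finset (ℤ × ℤ) := hTfin.toFinset with hTdef
  have hsubT : ∀ e ∈ E, ∀ g ∈ G, thickClass e g X Y ⊆ ↑T := fun e _ g _ x hx => by
    rw [hTdef, Set.Finite.coe_toFinset]
    exact thickClass_subset_thickSet e g X Y hx
  -- (iii) swap the sums; (ii) multiplicity `≤ d(|Δ|)² ≤ C₁²·X^{ε/2}` pointwise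
  have hswap := sum_ncard_thickClass_eq E G X Y hsubT
  have hXε : Y ^ δ ≤ X ^ (ε / 4) := by
    calc Y ^ δ ≤ (X ^ σ) ^ δ := Real.rpow_le_rpow hY0 hYX hδ0.le
      _ = X ^ (ε / 4) := by rw [← Real.rpow_mul hX0.le, hσδ]
  have hmult : ∀ x ∈ T,
      ((((E ×ˢ G).filter (fun q : ℕ × ℕ => x ∈ thickClass q.1 q.2 X Y)).card : ℕ) : ℝ) ≤
        C₁ ^ 2 * X ^ (ε / 2) := by
    intro x hxT
    obtain ⟨⟨-, -, hne, h1728, -, -, hDle, -⟩, -⟩ := (Set.Finite.mem_toFinset hTfin).mp hxT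
    set n : ℕ := ((x.1 ^ 3 - x.2 ^ 2) / 1728).natAbs
    have hnY : (n : ℝ) ≤ Y := natAbs_div_le h1728 hDle
    have h1 : ((((E ×ˢ G).filter (fun q : ℕ × ℕ => x ∈ thickClass q.1 q.2 X Y)).card : ℕ) : ℝ) ≤
        ((n.divisors.card : ℕ) : ℝ) ^ 2 := by
      exact_mod_cast card_filter_mem_thickClass_le E G X Y x
    have h2 : ((n.divisors.card : ℕ) : ℝ) ≤ C₁ * X ^ (ε / 4) :=
      calc ((n.divisors.card : ℕ) : ℝ) ≤ C₁ * (n : ℝ) ^ δ := hC₁ n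
        _ ≤ C₁ * Y ^ δ := by gcongr
        _ ≤ C₁ * X ^ (ε / 4) := by gcongr
    calc _ ≤ ((n.divisors.card : ℕ) : ℝ) ^ 2 := h1
      _ ≤ (C₁ * X ^ (ε / 4)) ^ 2 := by gcongr
      _ = C₁ ^ 2 * (X ^ (ε / 4) * X ^ (ε / 4)) := by ring
      _ = C₁ ^ 2 * X ^ (ε / 2) := by rw [← Real.rpow_add hX0, hε4]
  -- (i) `#T ≤ max C₀ 0 · X^{ε/2} · B` by the law on the thick tube
  have hT : (T.card : ℝ) ≤ max C₀ 0 * X ^ (ε / 2) * B := by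
    have h1 : (T.card : ℝ) = (Set.ncard {x : ℤ × ℤ | x ∈ cuspSetD X Y ∧ ThickTw Y x} : ℝ) := by
      rw [Set.ncard_eq_toFinset_card _ hTfin]
    rw [h1]
    calc (Set.ncard {x : ℤ × ℤ | x ∈ cuspSetD X Y ∧ ThickTw Y x} : ℝ) ≤ C₀ * X ^ (ε / 2) * B :=
          hC₀ X Y hX hY hXY hYX
      _ ≤ max C₀ 0 * X ^ (ε / 2) * B := by
          rw [mul_assoc, mul_assoc]
          exact mul_le_mul_of_nonneg_right (le_max_left _ _) (mul_nonneg (Real.rpow_nonneg hX0.le _) hB0)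
  -- assemble
  have hcast : (∑ e ∈ E, ∑ g ∈ G, (Set.ncard (thickClass e g X Y) : ℝ)) =
      ∑ x ∈ T, ((((E ×ˢ G).filter (fun q : ℕ × ℕ => x ∈ thickClass q.1 q.2 X Y)).card : ℕ) : ℝ) := by
    exact_mod_cast congrArg (Nat.cast : ℕ → ℝ) hswap
  rw [hcast]
  calc ∑ x ∈ T, ((((E ×ˢ G).filter (fun q : ℕ × ℕ => x ∈ thickClass q.1 q.2 X Y)).card : ℕ) : ℝ)
      ≤ ∑ x ∈ T, C₁ ^ 2 * X ^ (ε / 2) := Finset.sum_le_sum hmult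
    _ = (T.card : ℝ) * (C₁ ^ 2 * X ^ (ε / 2)) := by rw [Finset.sum_const, nsmul_eq_mul]
    _ ≤ (max C₀ 0 * X ^ (ε / 2) * B) * (C₁ ^ 2 * X ^ (ε / 2)) :=
        mul_le_mul_of_nonneg_right hT (by positivity)
    _ = max C₀ 0 * C₁ ^ 2 * (X ^ (ε / 2) * X ^ (ε / 2)) * B := by ring
    _ = max C₀ 0 * C₁ ^ 2 * X ^ ε * (X * Y ^ (-(1 / 6 : ℝ)) + 1) := by
        rw [← Real.rpow_add hX0, hε2]

end Summit.ABC.ABC.Theorems.SharpModerateLaw.CuspDispersion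

end
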